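import Summits.QuantumFields.QCD.Theses.HeatSlicedQuarks
import Summits.QuantumFields.QCD.Theses.GradientFlowSpecies
import Summits.QuantumFields.QCD.Theorems.HeatSlicedQuarksRobustYangMillsHandoverStubSmoothFieldFloor
import Summits.QuantumFields.QCD.Theorems.HeatSlicedQuarksRobustYangMillsHandoverStubHighBlockLocality
import Summits.QuantumFields.QCD.Theorems.HeatSlicedQuarksRobustYangMillsHandoverStubLocalModeBudget
import Summits.QuantumFields.QCD.Theorems.HeatSlicedQuarksRobustYangMillsHandoverStubLowModesHugRoughness
import Summits.QuantumFields.QCD.Theorems.HeatSlicedQuarksRobustYangMillsHandoverStubSpeciesGapTransfer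

/-!
# Line `low-mode-quarantine` — checked skeleton for the crux
`Summit.QuantumFields.QCD.Theses.HeatSlicedQuarks.RobustYangMillsHandover` (stmt-QuantumFields-8892)

**Gen 3 (lead c2 `…-c2-0`, 2026-08-16T18Z): HEAD RE-CUT ONLY, forced by the summit statement re-type p117723
(`QCDOf` now conjoins `reg.IsChiralAtZero`; `qcdOf_iff_threshold` is no longer a theorem and its olean is stale — crux dir
`FINDING-retype-chiral.md`, `RetypeImpact.lean`).  Imports of `GluonicCompletion.Negative.Threshold` / `Negative.GapClauses`
dropped; §3 now proves the heavy handover in its honest post-re-type form `aboveThreshold_of_speciesGapTransfer :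
… → ContinuumQCDExists → ∀ Nf ∈ {2,3}, QCDOfAboveThreshold Nf` (no `m_crit` shift) and closes the crux BY NAME through ONE
added open stub `stub_chiralCompletion` (the light-quark completion the re-type put inside the crux; crux-sized, promote-stub
material — identical to the two-scale line's).  Stubs 1–7 and their statuses are UNCHANGED; this gen is NOT registered (the
registered skeleton is the two-scale line's gen 4); it is published so that the line's landed content keeps elaborating.**

Planner crux-plan round 1 (gen 1), reshaped by the lead (gen 2, seat `…-c1`, 2026-08-16): the misstated shared
head `stub_gapTransfer` (= `GradientFlowSpecies.GapTransfer`, 8923 BY NAME; lead audit `GapTransfer-AUDIT.md`,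
standing disproof §13: `HasLatticeMassGap`'s per-pair constants / lattice times / local observables do not pass
to the limit) is REPLACED by the PROVED species-level transfer `stub_speciesGapTransfer` (landed as
`Theorems/HeatSlicedQuarksRobustYangMillsHandoverStubSpeciesGapTransfer.lean`): `IsQCDAlong sch T` + eventual
Cauchy–Schwarz (transfer-matrix form) clustering of the smeared species correlators on finite families of
slab-ordered real product data ⇒ `T.HasMassGap Δ`.  Correspondingly the two OPEN stubs now deliver, besides the
lattice gap clause `HasLatticeMassGap`, that species clustering clause (`SpeciesCSClustering`, §1) for every
species renormalisation `(z, shift)` — exactly what Lüscher's positive transfer matrix gives for an honest gapped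
lattice theory, so no honesty is lost and the composition no longer leans on 8923.

Idea card `Cruxes/RobustYangMillsHandover/Ideas/low-mode-quarantine.md` (ideator 2), triage `TRIAGE-r1-{1,2,3}.md`,
standing disproof `Cruxes/RobustYangMillsHandover/Disproof.lean` (cycles 1–3, §§1–13; landed negatives
`Theorems/RobustYangMillsHandover/Negative/{WithoutNontriviality,GapClauses,SchemeAsymptotics,FreeWilsonModes,HoppingWindow}.lean`),
`FINDINGS-g2k1.md`, drefute report `DREFUTE-low-mode-quarantine.md` (all seven gen-1 stubs survived).
Line card: `Cruxes/RobustYangMillsHandover/Lines/low-mode-quarantine.md`.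

## The crux and the line in one paragraph

The crux is the bare arrow `RobustYangMillsHandover := ContinuumQCDExists → QCD` (X₀ → QCD).  It suffices (§3,
sorry-free over the LANDED `Negative.GapClauses` and `qcdOf_iff_threshold`) to supply, for every X₀-honest
regularisation and every mass tuple above a `reg`-dependent threshold, (a) the lattice gap clause
`(reg.scheme m 0 0).HasLatticeMassGap Δ` and (b) the species clustering clause `SpeciesCSClustering (reg.scheme m z
shift) Δ` for all `(z, shift)`, which the PROVED `stub_speciesGapTransfer` turns into `T.HasMassGap Δ` for X₀'s own
witness `T`.  THIS LINE supplies (a)+(b) by the QUARANTINE MECHANISM of the card: at the heavy-quark handover (block)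
scale, where `|m_eff| ≥ m₀ = O(1)` in block units, the terminal Berezin integral factorises EXACTLY across the
singular-value cut `σ² = λ := m₀²/4` of the effective Dirac operator (§0 `intertwine_pow`, `cross_terms_vanish`);
the LOW block is finite, local and tame — empty on small fields (`stub_smoothFieldFloor`, LANDED), exponentially
localised on the rough plaquettes (`stub_lowModesHugRoughness`, LANDED), of rank budgeted LOCALLY by the Wilson
action of a collar of its support (`stub_localModeBudget`, LANDED), `|det D_low| ≤ λ^{N/2} ≤ 1`; the HIGH block is
coercive by construction and its functional calculus at spectral scale `λ` is quasi-local UNIFORMLY in the gauge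
field (`stub_highBlockLocality`, LANDED).  The handover theorem `stub_quarantinedDecoupling` turns these four
spectral facts into the TEMPERED lattice gap with species clustering (`TemperedQuarantineGapCS`): it CONTAINS the
Yang–Mills-strength input every line on this crux needs (β-universal, expansion-format robust `SU(3)` lattice
Yang–Mills at an asymptotically free block scale) and is the HARDEST stub (open / crux-sized); the HIERARCHICAL
corner (`stub_lightRemnantLatticeGap`, shared with geometric-mean-handover) is NOT the quarantine's business;
tempered ∨ hierarchical ⇒ `GradientFlowSpecies.MassiveLatticeGap` 8922 BY NAME (§3).

Registered stubs after the reshape (`sorry`s = the two open ones):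

* `stub_speciesGapTransfer`     : species CS clustering + `IsQCDAlong` ⇒ `T.HasMassGap`        — LANDED p97171 (this seat)
* `stub_smoothFieldFloor`       : no sub-threshold modes on `ε₀(m₀)`-smooth fields               — LANDED p88279
* `stub_lowModesHugRoughness`   : Agmon localisation of sub-threshold eigenmodes on roughness    — LANDED p93290
* `stub_localModeBudget`        : local, volume-free CLR below threshold                         — LANDED p91412
* `stub_highBlockLocality`      : `U`-uniform quadratic Combes–Thomas for `(DᴴD + λ)⁻¹`           — LANDED p90114
* `stub_quarantinedDecoupling`  : the four spectral facts ⇒ `TemperedQuarantineGapCS`           — open/XL, HARDEST (crux-sized)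
* `stub_lightRemnantLatticeGap` : hierarchical tuples ⇒ `LatticeGappedCS`                        — open (⊂ 8922 + species clause)

## Disproof.lean, honoured (cited by section)

* §1 `not_handover_iff` (landed `Negative.not_handover_iff`): X₀'s truth value is never used; the line proves the two
  gap clauses for X₀'s OWN witnesses (same-regularisation proof, §6).
* §2 `handoverWithoutNontriviality_iff_qcd` — a proof must USE the non-triviality of the handed-over `T`: honoured
  at `stub_quarantinedDecoupling`, whose hypothesis `Honest reg` carries the three non-triviality clauses.
* §5/§8: only the heavy regime above a `reg`-dependent threshold is owed; `qcdOf_iff_threshold` absorbs it (§3).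
* §6 `hasLatticeMassGap_scheme_indep`, `hasLatticeMassGap_anti` (landed, IMPORTED): stub 6 is §6's
  `SameRegLatticeGap` above a threshold (+ species clause); `SameRegContinuumGap` is discharged from the species
  clause by the PROVED transfer (no longer via 8923).
* §9(ii)/§10/§12: no accretivity / coercivity / hopping expansion of any TUNED fine operator is claimed anywhere;
  the quarantine lives at the BLOCK scale.
* §13 (quantifier audit of `GapTransfer`): ANSWERED by the reshape — the lattice hypothesis that transfers is the
  per-family, `ε`-slack, real-time Cauchy–Schwarz clustering of the species correlators with reflection-positive
  norms as constants (continuous functionals surviving the limit), not `HasLatticeMassGap`.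
* `-- Targets`: none (rev 8).
-/

noncomputable section

namespace Summit.QuantumFields.QCD.Cruxes.RobustYangMillsHandover.LowModeQuarantine

open scoped BigOperators Classical Matrix SchwartzMap
open Summit.QuantumFields.QCD.Theses.HeatSlicedQuarks (ContinuumQCDExists RobustYangMillsHandover)
open Literature.MathematicalPhysics.QuantumFieldTheory
open Literature.MathematicalPhysics.QuantumLattice
open Literature.Probability.LatticeModels (TorusSite)
open Filter Topology

/-! ## §0 The algebraic core of the exact singular-value factorisation (sorry-free, NOT stubs)

For ANY square complex matrix `D`: `D` intertwines the powers of `H = DᴴD` and `H̃ = DDᴴ`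
(`intertwine_pow`, hence every polynomial / entire cut-off built from the route's own semigroup is carried
across the singular-value decomposition), and the bilinear form `w̄ D v` has NO CROSS TERMS between an
eigenvector `v` of `H` and an eigenvector `w` of `H̃` with different eigenvalues (`cross_terms_vanish`).
In generators adapted to (low singular modes `σ² ≤ λ`) ⊕ (high) the Berezin integral therefore factorises
exactly: `∫dψ̄dψ e^{−ψ̄Dψ}(…) = [phase] · (finite N×N quarantined integral) · (coercive Gaussian integral)`
(card Lever; triage 1/3 re-checked).  These are the card's `HeatKernelIntertwining` /
`SingularCrossTermsVanish`, S-sized, proved here so that no stub is bookkeeping. -/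

section Algebra

variable {ι : Type*} [Fintype ι] [DecidableEq ι]

/-- `D (DᴴD)ⁿ = (DDᴴ)ⁿ D` for every square matrix `D` and every `n`. [folklore] -/
theorem intertwine_pow (D : Matrix ι ι ℂ) (n : ℕ) : D * (Dᴴ * D) ^ n = (D * Dᴴ) ^ n * D := by
  induction n with
  | zero => simp
  | succ n ih =>
    calc D * (Dᴴ * D) ^ (n + 1) = (D * (Dᴴ * D) ^ n) * (Dᴴ * D) := by rw [pow_succ, Matrix.mul_assoc]
      _ = (D * Dᴴ) ^ n * D * (Dᴴ * D) := by rw [ih]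
      _ = (D * Dᴴ) ^ n * (D * Dᴴ) * D := by simp only [Matrix.mul_assoc]
      _ = (D * Dᴴ) ^ (n + 1) * D := by rw [← pow_succ]

/-- Polynomial functional calculus is carried across: `D · p(DᴴD) = p(DDᴴ) · D` for every finite linear
combination of powers (e.g. truncated heat semigroups / Chebyshev cut-offs). [folklore] -/
theorem intertwine_sum (D : Matrix ι ι ℂ) (s : Finset ℕ) (c : ℕ → ℂ) :
    D * (∑ n ∈ s, c n • (Dᴴ * D) ^ n) = (∑ n ∈ s, c n • (D * Dᴴ) ^ n) * D := by
  rw [Finset.mul_sum, Finset.sum_mul]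
  refine Finset.sum_congr rfl fun n _ => ?_
  rw [Matrix.mul_smul, Matrix.smul_mul, intertwine_pow]

omit [DecidableEq ι] in
/-- **No cross terms.** If `(DᴴD) v = μ v` and `(DDᴴ) w = ν w` with real `μ ≠ ν`, then `w̄ · (D v) = 0`:
the quadratic form `ψ̄Dψ` is block-diagonal in generators adapted to the singular subspaces. [folklore] -/
theorem cross_terms_vanish (D : Matrix ι ι ℂ) (v w : ι → ℂ) (μ ν : ℝ)
    (hv : (Dᴴ * D) *ᵥ v = (μ : ℂ) • v) (hw : (D * Dᴴ) *ᵥ w = (ν : ℂ) • w) (hne : μ ≠ ν) :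
    star w ⬝ᵥ (D *ᵥ v) = 0 := by
  -- compute `star w ⬝ᵥ (D DᴴD v)` in two ways
  have h1 : star w ⬝ᵥ ((D * (Dᴴ * D)) *ᵥ v) = (μ : ℂ) * (star w ⬝ᵥ (D *ᵥ v)) := by
    rw [← Matrix.mulVec_mulVec, hv, Matrix.mulVec_smul, dotProduct_smul, smul_eq_mul]
  have h2 : star w ⬝ᵥ ((D * (Dᴴ * D)) *ᵥ v) = (ν : ℂ) * (star w ⬝ᵥ (D *ᵥ v)) := by
    have hassoc : D * (Dᴴ * D) = (D * Dᴴ) * D := (Matrix.mul_assoc _ _ _).symm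
    rw [hassoc, ← Matrix.mulVec_mulVec, Matrix.dotProduct_mulVec]
    -- `star w ᵥ* (D Dᴴ) = star ((D Dᴴ)ᴴ *ᵥ w) = star ((D Dᴴ) *ᵥ w) = star (ν • w) = ν • star w`
    have hH : (D * Dᴴ)ᴴ = D * Dᴴ := by rw [Matrix.conjTranspose_mul, Matrix.conjTranspose_conjTranspose]
    have hvm : star w ᵥ* (D * Dᴴ) = (ν : ℂ) • star w := by
      conv_lhs => rw [← hH]
      rw [← Matrix.star_mulVec, hw, star_smul, ← starRingEnd_apply, Complex.conj_ofReal]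
    rw [hvm, smul_dotProduct, smul_eq_mul]
  have h3 : ((μ : ℂ) - ν) * (star w ⬝ᵥ (D *ᵥ v)) = 0 := by rw [sub_mul, ← h1, ← h2, sub_self]
  rcases mul_eq_zero.mp h3 with h | h
  · exact absurd (by exact_mod_cast sub_eq_zero.mp h) hne
  · exact h

end Algebra

/-! ## §1 Packaged vocabulary (definitions only; stubs 2–5 are LANDED with these texts UNFOLDED) -/

local notation "SU3" => Matrix.specialUnitaryGroup (Fin 3) ℂ
local notation "ρ₃" => fundamentalRep (Fin 3)

/-- **Smooth-field spectral floor**: for every `m₀ ∈ (0, 1]` there is `ε₀ = ε₀(m₀) > 0` such that for every torus,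
every `SU(3)` field ALL of whose plaquettes have deficit `3 − Re tr U_p ≤ ε₀`, and every bare mass in the route's
window `m ∈ [−1/2, 1]` with `|m| ≥ m₀`, `‖D_W v‖² ≥ (m₀²/2)‖v‖²`. -/
def SmoothFieldFloor : Prop :=
  ∀ m₀ : ℝ, 0 < m₀ → m₀ ≤ 1 → ∃ ε₀ : ℝ, 0 < ε₀ ∧
    ∀ (L : ℕ) [NeZero L] (U : GaugeConfig 4 L SU3) (m : ℝ), m ∈ Set.Icc (-(1 / 2 : ℝ)) 1 → m₀ ≤ |m| →
      (∀ (y : TorusSite 4 L) (μ ν : Fin 4), 3 - ((ρ₃ (plaquetteHolonomy U y μ ν)).trace).re ≤ ε₀) →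
        ∀ v : TorusSite 4 L × Fin 3 × Fin 4 → ℂ,
          m₀ ^ 2 / 2 * ∑ i, ‖v i‖ ^ 2 ≤ ∑ i, ‖(wilsonDirac ρ₃ U m 1).mulVec v i‖ ^ 2

/-- **Low modes hug the roughness** (lattice Agmon): sub-threshold eigenmodes of `H_U = D_Wᴴ D_W` (eigenvalue
`e ∈ [0, m₀²/4]`) are exponentially small at torus distance `n` from the set of `ε₀`-rough plaquettes. -/
def LowModesHugRoughness : Prop :=
  ∀ m₀ : ℝ, 0 < m₀ → m₀ ≤ 1 → ∃ ε₀ c C : ℝ, 0 < ε₀ ∧ 0 < c ∧ 0 < C ∧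
    ∀ (L : ℕ) [NeZero L] (U : GaugeConfig 4 L SU3) (m : ℝ), m ∈ Set.Icc (-(1 / 2 : ℝ)) 1 → m₀ ≤ |m| →
      ∀ (v : TorusSite 4 L × Fin 3 × Fin 4 → ℂ) (e : ℝ), 0 ≤ e → e ≤ m₀ ^ 2 / 4 →
        ((wilsonDirac ρ₃ U m 1)ᴴ * wilsonDirac ρ₃ U m 1).mulVec v = (e : ℂ) • v →
          ∀ (x : TorusSite 4 L) (n : ℕ),
            (∀ y : TorusSite 4 L, (∃ μ ν : Fin 4, ε₀ ≤ 3 - ((ρ₃ (plaquetteHolonomy U y μ ν)).trace).re) →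
              n ≤ torusDist x y) →
            ∑ a : Fin 3, ∑ α : Fin 4, ‖v (x, a, α)‖ ^ 2 ≤ C * Real.exp (-(c * n)) * ∑ i, ‖v i‖ ^ 2

/-- **Local mode budget** (local, volume-free CLR below the free threshold). -/
def LocalModeBudget : Prop :=
  ∀ m₀ : ℝ, 0 < m₀ → m₀ ≤ 1 → ∃ (R : ℕ) (C : ℝ),
    ∀ (L : ℕ) [NeZero L] (U : GaugeConfig 4 L SU3) (m : ℝ), m ∈ Set.Icc (-(1 / 2 : ℝ)) 1 → m₀ ≤ |m| →
      ∀ (Z : Finset (TorusSite 4 L)) (E : Submodule ℂ (TorusSite 4 L × Fin 3 × Fin 4 → ℂ)),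
        (∀ v ∈ E, ∀ x ∉ Z, ∀ (a : Fin 3) (α : Fin 4), v (x, a, α) = 0) →
        (∀ v ∈ E, ∑ i, ‖(wilsonDirac ρ₃ U m 1).mulVec v i‖ ^ 2 ≤ m₀ ^ 2 / 4 * ∑ i, ‖v i‖ ^ 2) →
          (Module.finrank ℂ E : ℝ) ≤ C * ((∑ y ∈ Finset.univ.filter
              (fun y : TorusSite 4 L => ∃ z ∈ Z, torusDist y z ≤ R),
            ∑ μ : Fin 4, ∑ ν : Fin 4, (3 - ((ρ₃ (plaquetteHolonomy U y μ ν)).trace).re)) + 1)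

/-- **High-block locality** (`U`-uniform quadratic Combes–Thomas at spectral scale `λ`). -/
def HighBlockLocality : Prop :=
  ∃ C c : ℝ, 0 < c ∧ ∀ (L : ℕ) [NeZero L] (U : GaugeConfig 4 L SU3) (m : ℝ), m ∈ Set.Icc (-1 : ℝ) 1 →
    ∀ lam : ℝ, 0 < lam → lam ≤ 1 →
      ∀ (x y : TorusSite 4 L) (a b : Fin 3) (α β : Fin 4),
        ‖((wilsonDirac ρ₃ U m 1)ᴴ * wilsonDirac ρ₃ U m 1 +
            (lam : ℂ) • (1 : Matrix (TorusSite 4 L × Fin 3 × Fin 4) (TorusSite 4 L × Fin 3 × Fin 4) ℂ))⁻¹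
            (x, a, α) (y, b, β)‖ ≤ C / lam * Real.exp (-(c * Real.sqrt lam * torusDist x y))

/-- **Honesty of a regularisation** (= Disproof.lean's `IsTargetReg`, the `∃ reg`-body of the route target X₀ at one
`N_f`; VERBATIM the hypothesis body of `GradientFlowSpecies.MassiveLatticeGap` 8922). [folklore] -/
def Honest {Nf : ℕ} (reg : QCDRegularisation Nf) : Prop :=
  reg.HasMassScaling ∧ ∀ m : Fin Nf → ℝ, (∀ f, 0 < m f) →
    ∃ (z shift : QCDField Nf → ℕ → ℝ) (T : OSData (QCDField Nf) 4),
      IsQCDAlong (reg.scheme m z shift) T ∧ T.IsNontrivial QCDField.glue ∧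
        T.IsNonGaussian QCDField.glue ∧ ∀ f g : Fin Nf, f ≠ g → T.IsNontrivial (QCDField.pseudoRe f g)

/-- **The lattice-gap content at `(reg, m)`** (Disproof §6 `LatticeGapped`): some `Δ > 0` gaps lattice QCD along the
bare trajectory `m_f(k) = m_crit(k) + a_k m_f / Z_m(k)`, uniformly in the volume. [folklore] -/
def LatticeGapped {Nf : ℕ} (reg : QCDRegularisation Nf) (m : Fin Nf → ℝ) : Prop :=
  ∃ Δ : ℝ, 0 < Δ ∧ (reg.scheme m 0 0).HasLatticeMassGap Δ

/-- **Species Cauchy–Schwarz clustering along a scheme at rate `Δ`** (gen-2 reshape; the hypothesis of the PROVED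
`stub_speciesGapTransfer`, VERBATIM its text): for all arities `n, m ≥ 1`, species strings `σ, σ'`, finite
families of slab-ordered real factor data `p, q` with coefficients `c, c'`, all `t ≥ 0` and `ε > 0`, eventually in
`k` the lattice correlators `𝔖ᵏ = qcdLatticeSchwinger sch k` obey the transfer-matrix form of clustering
`‖∑ᵢⱼ c̄ᵢ c'ⱼ (𝔖ᵏ(θpᵢʳ ++ T_t qⱼ) − 𝔖ᵏ(θpᵢʳ) 𝔖ᵏ(qⱼ))‖ ≤ e^{−Δt} √‖∑ c̄ᵢcᵢ' 𝔖ᵏ(θpᵢʳ ++ pᵢ')‖ √‖∑ c̄'ⱼc'ⱼ'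
𝔖ᵏ(θqⱼʳ ++ qⱼ')‖ + ε` — `|⟨F̂Ω,(e^{−tH} − |Ω⟩⟨Ω|)ĜΩ⟩| ≤ e^{−Δt}‖F̂Ω‖‖ĜΩ‖` on the lattice, which is what
Lüscher's positive transfer matrix with spectral gap `Δ` (physical units) gives for EVERY species renormalisation.
[cite: Luscher1977] [cite: OsterwalderSeiler1978, §§2–4] -/
def SpeciesCSClustering {Nf : ℕ} (sch : QCDScheme Nf) (Δ : ℝ) : Prop :=
  ∀ (n m : ℕ), n ≠ 0 → m ≠ 0 → ∀ (σ : Fin n → QCDField Nf) (σ' : Fin m → QCDField Nf)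
    (N N' : ℕ) (c : Fin N → ℂ) (c' : Fin N' → ℂ)
    (p : Fin N → Fin n → 𝓢(EuclideanSpace ℝ (Fin 4), ℝ))
    (q : Fin N' → Fin m → 𝓢(EuclideanSpace ℝ (Fin 4), ℝ)),
    (∀ i, ∃ lo hi : Fin n → ℝ, (∀ l, 0 < lo l) ∧ (∀ l, lo l ≤ hi l) ∧
        (∀ l l', l < l' → hi l < lo l') ∧
        ∀ l, tsupport (p i l : EuclideanSpace ℝ (Fin 4) → ℝ) ⊆ {x | lo l ≤ x 0 ∧ x 0 ≤ hi l}) →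
    (∀ j, ∃ lo hi : Fin m → ℝ, (∀ l, 0 < lo l) ∧ (∀ l, lo l ≤ hi l) ∧
        (∀ l l', l < l' → hi l < lo l') ∧
        ∀ l, tsupport (q j l : EuclideanSpace ℝ (Fin 4) → ℝ) ⊆ {x | lo l ≤ x 0 ∧ x 0 ≤ hi l}) →
    ∀ t : ℝ, 0 ≤ t → ∀ ε : ℝ, 0 < ε → ∀ᶠ k in atTop,
      ‖∑ i, ∑ j, (starRingEnd ℂ) (c i) * c' j *
          (qcdLatticeSchwinger sch k (n + m) (Fin.append (σ ∘ Fin.rev) σ')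
              (Fin.append (fun l => thetaTest 4 (p i (Fin.rev l)))
                (fun l => translateTest (EuclideanSpace.single 0 t) (q j l))) -
            qcdLatticeSchwinger sch k n (σ ∘ Fin.rev) (fun l => thetaTest 4 (p i (Fin.rev l))) *
              qcdLatticeSchwinger sch k m σ' (q j))‖ ≤
        Real.exp (-Δ * t) *
            Real.sqrt ‖∑ i, ∑ i', (starRingEnd ℂ) (c i) * c i' *
              qcdLatticeSchwinger sch k (n + n) (Fin.append (σ ∘ Fin.rev) σ)
                (Fin.append (fun l => thetaTest 4 (p i (Fin.rev l))) (p i'))‖ *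
            Real.sqrt ‖∑ j, ∑ j', (starRingEnd ℂ) (c' j) * c' j' *
              qcdLatticeSchwinger sch k (m + m) (Fin.append (σ' ∘ Fin.rev) σ')
                (Fin.append (fun l => thetaTest 4 (q j (Fin.rev l))) (q j'))‖ +
          ε

/-- **The lattice content at `(reg, m)`, gen-2 form**: one rate `Δ > 0` that gaps lattice QCD along the bare
trajectory (all local observables, uniformly in the volume — the summit's `HasLatticeMassGap`, which does not read
`z, shift`) AND clusters the smeared species correlators in Cauchy–Schwarz form for every species renormalisation
`(z, shift)` (the clause the continuum gap is read off from). [folklore] -/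
def LatticeGappedCS {Nf : ℕ} (reg : QCDRegularisation Nf) (m : Fin Nf → ℝ) : Prop :=
  ∃ Δ : ℝ, 0 < Δ ∧ (reg.scheme m 0 0).HasLatticeMassGap Δ ∧
    ∀ z shift : QCDField Nf → ℕ → ℝ, SpeciesCSClustering (reg.scheme m z shift) Δ

/-- **Tempered quarantine gap, gen-2 form** — the conclusion of the handover theorem (stub 6): for `N_f = 2, 3`,
every HONEST regularisation and every ratio bound `Rm ≥ 1` there is a threshold `M₁` above which every
`Rm`-TEMPERED mass tuple (`m_f ≤ Rm · m_g`) is `LatticeGappedCS`.  Tempered because decoupling RAISES the effective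
pure-gauge scale; along tempered tuples all quarks ARE heavy at the handover scale. -/
def TemperedQuarantineGapCS : Prop :=
  ∀ Nf : ℕ, Nf = 2 ∨ Nf = 3 → ∀ reg : QCDRegularisation Nf, Honest reg →
    ∀ Rm : ℝ, 1 ≤ Rm → ∃ M₁ : ℝ, ∀ m : Fin Nf → ℝ, (∀ f, M₁ < m f) → (∀ f g, m f ≤ Rm * m g) →
      LatticeGappedCS reg m

/-- **LightRemnantLatticeGapCS** — the hierarchical corner, gen-2 form (shared obligation with the sibling line
geometric-mean-handover; NOT the quarantine's mechanism): for `N_f ∈ {2,3}` and every honest regularisation there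
are a ratio bound `Rm ≥ 1` and a threshold `M₂` such that every tuple above `M₂` with SOME ratio `m_f/m_g > Rm` is
`LatticeGappedCS`.  Content: few-LIGHT-flavour massive lattice QCD gap (+ species clustering), uniformly in the
volume; as hard as the summit's gap clause in that regime. [cite: JaffeWitten2000, §5] [cite: AppelquistCarazzone1975] -/
def LightRemnantLatticeGapCS : Prop :=
  ∀ Nf : ℕ, Nf = 2 ∨ Nf = 3 → ∀ reg : QCDRegularisation Nf, Honest reg →
    ∃ Rm : ℝ, 1 ≤ Rm ∧ ∃ M₂ : ℝ, ∀ m : Fin Nf → ℝ, (∀ f, M₂ < m f) →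
      (∃ f g, Rm * m g < m f) → LatticeGappedCS reg m

/-! ## §2 The registered stubs (the only `sorry`s of the line) -/

/- stub_speciesGapTransfer — LANDED (p97171, this seat): `Theorems/HeatSlicedQuarksRobustYangMillsHandoverStubSpeciesGapTransfer.lean`
(imported; theorem `stub_speciesGapTransfer` in this namespace): `∀ Nf sch T Δ, IsQCDAlong sch T → <text of
SpeciesCSClustering sch Δ, inlined> → T.HasMassGap Δ` — the continuum half, correctly shaped: degree `0` by E4 + E1; on
the span of slab-ordered real product tensors by sesquilinear expansion and `IsQCDAlong` limits termwise (reflection-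
positive norms as the continuous constants); general time-ordered `F, G` by continuity of both sides and the
ordered-wedge density `IsTimeOrdered.mem_closure_span_slabOrderedProducts`.  USED by §3 at `sch := reg.scheme m z shift`. -/

/- stub_smoothFieldFloor — LANDED (p88279): `Theorems/HeatSlicedQuarksRobustYangMillsHandoverStubSmoothFieldFloor.lean`
(imported; theorem `stub_smoothFieldFloor` in this namespace, ε₀ = m₀⁴/7200; engine = Neuberger's bound). -/

/- stub_lowModesHugRoughness — LANDED (p93290): `Theorems/HeatSlicedQuarksRobustYangMillsHandoverStubLowModesHugRoughness.lean`
(imported; theorem `stub_lowModesHugRoughness` in this namespace, ε₀ = 9m₀⁴/125000, c = 2 log(1+m₀/960)). -/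

/- stub_localModeBudget — LANDED (p91412): `Theorems/HeatSlicedQuarksRobustYangMillsHandoverStubLocalModeBudget.lean`
(imported; theorem `stub_localModeBudget` in this namespace, ε₀ = m₀⁴/28800, R = 1 + ⌈400/m₀⌉₊). -/

/- stub_highBlockLocality — LANDED (p90114): `Theorems/HeatSlicedQuarksRobustYangMillsHandoverStubHighBlockLocality.lean`
(imported; theorem `stub_highBlockLocality` in this namespace, C = 2, c = 1/384; engine = quadratic Combes–Thomas). -/

/-- **stub_quarantinedDecoupling — THE HANDOVER THEOREM (HARDEST; open / XL, crux-sized)**: the four spectral facts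
imply `TemperedQuarantineGapCS` — for `N_f = 2, 3`, every X₀-HONEST regularisation `reg` (INCLUDING the three
non-triviality clauses — Disproof §2 honoured here) and every ratio bound `Rm ≥ 1`, there is a threshold `M₁` such
that for every `Rm`-tempered mass tuple above `M₁` lattice QCD at `β_k` and the honest bare masses
`m_crit(k) + a_k m_f/Z_m(k)` has ONE rate `Δ > 0` giving the volume-uniform lattice gap `(reg.scheme m 0 0).HasLatticeMassGap Δ`
(all gauge-invariant local observables) AND the Cauchy–Schwarz clustering of the smeared species correlators
`SpeciesCSClustering (reg.scheme m z shift) Δ` for every `(z, shift)` — both read off Lüscher's positive transfer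
matrix once its spectral gap `≥ Δ` in physical units is established eventually in `k`.
MECHANISM (card + triage; every step at the BLOCK scale, never at the fine lattice — Disproof §9(ii)):
(1) FLOW to the handover scale along `reg`'s honest bare data (route crux `InterleavedHeatSliceFlow` 8891, UNPROVED)
    down to an asymptotically free block scale `ℓ₀` with `ℓ₀ M ≍ K` large, so that the block-effective Dirac operator
    `D` has `|m_eff| ≥ m₀ = O(1)` in block units and the pure-gauge remainder is matched to Wilson YM at `β_eff`
    (`CouplingMatching` 8797) plus an irrelevant remainder two-sided `≤ C(ℓ₀M)⁻²` on small-field blocks.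
(2) QUARANTINE at `λ = m₀²/4`: the terminal Berezin integral factorises EXACTLY across the singular-value cut (§0);
    `h₁` ⇒ the low block is EMPTY on small-field regions; `h₂` ⇒ the low modes are supported on the `R`-collars of
    large-field regions up to `e^{−c·dist}` tails; `h₃` ⇒ per large-field region `X` the rank is
    `N_X ≤ C(m₀)(s_W(X⁺) + 1)`, paid by Wilson's `e^{−β_k s_W}` with unbounded slack; `h₄` ⇒ the high block's
    covariance and `tr log` are quasi-local uniformly in the field; `|det D_low| ≤ λ^{N/2} ≤ 1` carries the WHOLE sign.
(3) GAP from the format: (positive, Kotecký–Preiss-controlled bulk around Wilson YM at `β_eff(ℓ₀)`) × `∏_X` (signed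
    factors of modulus `≤ 1` on large-field polymers) ⇒ convergent cluster expansion for `log Z` and for the connected
    correlations of all gauge-invariant local lattice observables, uniformly in `S ≥ L_k`, eventually in `k` ⇒
    `HasLatticeMassGap Δ(m)` and, through Lüscher's transfer matrix on the physical Hilbert space, the species
    clustering.  THIS STEP CONTAINS THE YANG–MILLS INPUT every line on this crux needs and no printed theorem supplies:
    EXPANSION-FORMAT control of pure `SU(3)` lattice Yang–Mills at the a.f. block scale `ℓ₀`, β-UNIVERSAL along the
    matched sequences (FINDINGS B1/B2/B4).
WHY IT MIGHT FAIL: it contains the weak-coupling `SU(3)` lattice Yang–Mills gap in β- and format-universal form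
(open; barrier `PerturbativeInvisibility`); large-field polymers are ABUNDANT per correlation volume at an a.f.
handover scale (FINDINGS B3); the phase of `det D_high` must be tracked through the bulk expansion.  NOT refutable by
junk: the hypothesis excludes `canonicalAF` / `z = 0` (Disproof §2–§3), the threshold is per `reg`.
Sources: Balaban1988Convergent, Balaban1989LargeFieldII, BalabanOcarrollSchor1989, Seiler1982 Ch. 3,
KoteckyPreiss1986, Luscher1977, JaffeWitten2000 §5. -/
theorem stub_quarantinedDecoupling :
    SmoothFieldFloor → LowModesHugRoughness → LocalModeBudget → HighBlockLocality →
      TemperedQuarantineGapCS := by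
  sorry

/-- **stub_lightRemnantLatticeGap — THE HIERARCHICAL CORNER (open; NOT this line's mechanism)** =
`LightRemnantLatticeGapCS` above (the gen-1 shared obligation `LightRemnantLatticeGap` of the sibling line
`Lines/geometric-mean-handover.lean` ⊂ item 8922, strengthened by the species clustering clause).  Size:
open-problem (few-light-flavour massive lattice QCD gap); a prover should NOT start here. [cite: JaffeWitten2000, §5] -/
theorem stub_lightRemnantLatticeGap : LightRemnantLatticeGapCS := by
  sorry

/-! ## §3 The composition (sorry-free): the registered stubs ⇒ the crux BY NAME -/

/-- The gen-2 lattice content implies the gen-1 one (drop the species clause). [folklore] -/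
theorem latticeGapped_of_CS {Nf : ℕ} {reg : QCDRegularisation Nf} {m : Fin Nf → ℝ}
    (h : LatticeGappedCS reg m) : LatticeGapped reg m := by
  obtain ⟨Δ, hΔ, hL, -⟩ := h
  exact ⟨Δ, hΔ, hL⟩

/-- **The lattice half, per-regularisation threshold form** from the tempered handover and the hierarchical remnant
(pure logic: `Rm, M₂` from the remnant → `M₁` from the handover at that `Rm` → threshold `max (max M₁ M₂) 0`). [folklore] -/
theorem latticeGappedCS_aboveThreshold (hT : TemperedQuarantineGapCS) (hL : LightRemnantLatticeGapCS) {Nf : ℕ}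
    (hNf : Nf = 2 ∨ Nf = 3) (reg : QCDRegularisation Nf) (hreg : Honest reg) :
    ∃ M : ℝ, 0 ≤ M ∧ ∀ m : Fin Nf → ℝ, (∀ f, M < m f) → LatticeGappedCS reg m := by
  obtain ⟨Rm, hRm, M₂, hL'⟩ := hL Nf hNf reg hreg
  obtain ⟨M₁, hT'⟩ := hT Nf hNf reg hreg Rm hRm
  refine ⟨max (max M₁ M₂) 0, le_max_right _ _, fun m hm => ?_⟩
  have hm1 : ∀ f, M₁ < m f := fun f =>
    lt_of_le_of_lt ((le_max_left M₁ M₂).trans (le_max_left _ _)) (hm f)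
  have hm2 : ∀ f, M₂ < m f := fun f =>
    lt_of_le_of_lt ((le_max_right M₁ M₂).trans (le_max_left _ _)) (hm f)
  by_cases htemp : ∀ f g, m f ≤ Rm * m g
  · exact hT' m hm1 htemp
  · simp only [not_forall, not_le] at htemp
    obtain ⟨f, g, hfg⟩ := htemp
    exact hL' m hm2 ⟨f, g, hfg⟩

/-- The lattice-half residual `GradientFlowSpecies.MassiveLatticeGap` (8922) BY NAME from this line (stubs 2–5 feed
stub 6, stub 7 covers the hierarchical corner; 8922's hypothesis body is `Honest reg` verbatim). [folklore] -/
theorem massiveLatticeGap_of_quarantine :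
    Summit.QuantumFields.QCD.Theses.GradientFlowSpecies.MassiveLatticeGap := by
  intro Nf hNf reg hreg
  obtain ⟨M, -, hM⟩ := latticeGappedCS_aboveThreshold
    (stub_quarantinedDecoupling stub_smoothFieldFloor stub_lowModesHugRoughness stub_localModeBudget
      stub_highBlockLocality) stub_lightRemnantLatticeGap hNf reg hreg
  exact ⟨M, fun m hm => latticeGapped_of_CS (hM m hm)⟩

/-- **The pre-re-type conjunct in threshold form** (verbatim the RHS of the former `qcdOf_iff_threshold`; crux dir
`RetypeImpact.lean`): honest data and BOTH gap clauses above an unpinned common offset `M₀ ≥ 0` of ONE regularisation —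
the strongest statement a heavy-quark handover reaches after the re-type p117723. [folklore] -/
def QCDOfAboveThreshold (Nf : ℕ) : Prop :=
  ∃ M₀ : ℝ, 0 ≤ M₀ ∧ ∃ reg : QCDRegularisation Nf,
    reg.HasMassScaling ∧ ∀ m : Fin Nf → ℝ, (∀ f, M₀ < m f) →
      ∃ (z shift : QCDField Nf → ℕ → ℝ) (T : OSData (QCDField Nf) 4),
        IsQCDAlong (reg.scheme m z shift) T ∧ T.IsNontrivial QCDField.glue ∧ T.IsNonGaussian QCDField.glue ∧
          (∀ f g : Fin Nf, f ≠ g → T.IsNontrivial (QCDField.pseudoRe f g)) ∧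
            ∃ Δ > 0, T.HasMassGap Δ ∧ (reg.scheme m z shift).HasLatticeMassGap Δ

/-- **The gen-3 head (post-re-type)**: tempered handover + hierarchical remnant + the PROVED species transfer ⇒ the
heavy-quark handover in threshold form, `ContinuumQCDExists → QCDOfAboveThreshold N_f`, over X₀'s OWN regularisation and
WITHOUT any `m_crit` shift: X₀ gives `reg` with `HasMassScaling` and the honest body `hb`; §3 gives the threshold `M`; for
`m > max M 0`, X₀ supplies `(z, shift, T)` (non-triviality clauses passed on verbatim — Disproof §2), the lattice content
supplies ONE `Δ > 0` with the lattice gap of `reg.scheme m 0 0` — the same clause for `reg.scheme m z shift`, which has the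
same `β, mq, L, a` (definitional) — and the species clustering of `reg.scheme m z shift`, which `stub_speciesGapTransfer`
turns into `T.HasMassGap Δ`. [folklore] -/
theorem aboveThreshold_of_speciesGapTransfer (hT : TemperedQuarantineGapCS) (hL : LightRemnantLatticeGapCS)
    (hX : ContinuumQCDExists) : ∀ Nf : ℕ, Nf = 2 ∨ Nf = 3 → QCDOfAboveThreshold Nf := by
  intro Nf hNf
  obtain ⟨reg, hms, hb⟩ := hX Nf hNf
  obtain ⟨M, -, hM⟩ := latticeGappedCS_aboveThreshold hT hL hNf reg ⟨hms, hb⟩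
  refine ⟨max M 0, le_max_right _ _, reg, hms, fun m hm => ?_⟩
  have hm0 : ∀ f, 0 < m f := fun f => lt_of_le_of_lt (le_max_right M 0) (hm f)
  have hmM : ∀ f, M < m f := fun f => lt_of_le_of_lt (le_max_left M 0) (hm f)
  obtain ⟨z, shift, T, hA, hN, hG, hP⟩ := hb m hm0
  obtain ⟨Δ, hΔ, hLat, hCS⟩ := hM m hmM
  have hLat' : (reg.scheme m z shift).HasLatticeMassGap Δ := hLat
  exact ⟨z, shift, T, hA, hN, hG, hP, Δ, hΔ,
    stub_speciesGapTransfer Nf (reg.scheme m z shift) T Δ hA (hCS z shift), hLat'⟩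

/-- **stub_chiralCompletion — THE LIGHT-QUARK COMPLETION (open; CRUX-SIZED; the NEW content the statement re-type
p117723 placed inside this crux; NOT this line's mechanism; identical to the two-scale line's stub 7).**  From the
heavy-regime conjunct for both flavour numbers to the re-typed `QCD` (a CHIRAL-AT-ZERO regularisation gapped at ALL
positive masses): locate the chiral point of the bare trajectory, shift to it, and supply continuum existence, both gap
clauses down to it and gaplessness at it — light-quark QCD.  Here only so that `RobustYangMillsHandover_of` concludes the
crux BY NAME against the re-typed statement; promote-stub / restatement material (`FINDING-retype-chiral.md`).
[cite: JaffeWitten2000, §5] -/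
theorem stub_chiralCompletion :
    (∀ Nf : ℕ, Nf = 2 ∨ Nf = 3 → QCDOfAboveThreshold Nf) → _root_.QCD := by
  sorry

/-- **RobustYangMillsHandover_of — the line closes the crux modulo exactly its stubs (6, 7 open) plus the chiral
completion.** (`RobustYangMillsHandover` unfolds to `ContinuumQCDExists → QCD`; the conclusion is the route decl BY NAME.) -/
theorem RobustYangMillsHandover_of :
    Summit.QuantumFields.QCD.Theses.HeatSlicedQuarks.RobustYangMillsHandover :=
  fun hX => stub_chiralCompletion
    (aboveThreshold_of_speciesGapTransfer
      (stub_quarantinedDecoupling stub_smoothFieldFloor stub_lowModesHugRoughness stub_localModeBudget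
        stub_highBlockLocality) stub_lightRemnantLatticeGap hX)

/-! ## §4 Sanity links (sorry-free, not registered) -/

/-- The packaged names are the unfolded stub texts (definitional). [folklore] -/
theorem packaged_iff :
    (SmoothFieldFloor ↔
      ∀ m₀ : ℝ, 0 < m₀ → m₀ ≤ 1 → ∃ ε₀ : ℝ, 0 < ε₀ ∧
        ∀ (L : ℕ) [NeZero L] (U : GaugeConfig 4 L (Matrix.specialUnitaryGroup (Fin 3) ℂ)) (m : ℝ),
          m ∈ Set.Icc (-(1 / 2 : ℝ)) 1 → m₀ ≤ |m| →
          (∀ (y : TorusSite 4 L) (μ ν : Fin 4),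
            3 - ((fundamentalRep (Fin 3) (plaquetteHolonomy U y μ ν)).trace).re ≤ ε₀) →
            ∀ v : TorusSite 4 L × Fin 3 × Fin 4 → ℂ,
              m₀ ^ 2 / 2 * ∑ i, ‖v i‖ ^ 2 ≤
                ∑ i, ‖(wilsonDirac (fundamentalRep (Fin 3)) U m 1).mulVec v i‖ ^ 2) ∧
    (HighBlockLocality ↔
      ∃ C c : ℝ, 0 < c ∧
        ∀ (L : ℕ) [NeZero L] (U : GaugeConfig 4 L (Matrix.specialUnitaryGroup (Fin 3) ℂ)) (m : ℝ),
          m ∈ Set.Icc (-1 : ℝ) 1 → ∀ lam : ℝ, 0 < lam → lam ≤ 1 →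
            ∀ (x y : TorusSite 4 L) (a b : Fin 3) (α β : Fin 4),
              ‖((wilsonDirac (fundamentalRep (Fin 3)) U m 1)ᴴ * wilsonDirac (fundamentalRep (Fin 3)) U m 1 +
                  (lam : ℂ) • (1 : Matrix (TorusSite 4 L × Fin 3 × Fin 4)
                    (TorusSite 4 L × Fin 3 × Fin 4) ℂ))⁻¹ (x, a, α) (y, b, β)‖ ≤
                C / lam * Real.exp (-(c * Real.sqrt lam * torusDist x y))) :=
  ⟨Iff.rfl, Iff.rfl⟩

/-- The gen-2 lattice content is the gen-1 content plus the species clause (definitional). [folklore] -/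
theorem latticeGappedCS_iff {Nf : ℕ} (reg : QCDRegularisation Nf) (m : Fin Nf → ℝ) :
    LatticeGappedCS reg m ↔ ∃ Δ : ℝ, 0 < Δ ∧ (reg.scheme m 0 0).HasLatticeMassGap Δ ∧
      ∀ z shift : QCDField Nf → ℕ → ℝ, SpeciesCSClustering (reg.scheme m z shift) Δ :=
  Iff.rfl

/-- Sanity link: the crux IS the arrow §3 concludes. [folklore] -/
theorem robustYangMillsHandover_iff :
    Summit.QuantumFields.QCD.Theses.HeatSlicedQuarks.RobustYangMillsHandover ↔
      (ContinuumQCDExists → _root_.QCD) :=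
  Iff.rfl

end Summit.QuantumFields.QCD.Cruxes.RobustYangMillsHandover.LowModeQuarantine
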